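import Summits.AtomisticToContinuum.Crystallization.Theorems.FrustratedLawDichotomyStrainedPatchHomCertTree
import Summits.AtomisticToContinuum.Crystallization.Theorems.FrustratedLawDichotomyStrainedPatchHomLeafCalculus
import Summits.AtomisticToContinuum.Crystallization.Theorems.FrustratedLawDichotomyStrainedPatchHomCover

/-!
# ENTRY-COORDINATE fcc leaves for the `HomFloor` certificate: entry → Gram interval squaring, two free prunes, and the fcc half of
# `homFloor_of_prunedBoxSums_selfAdjoint` from ONE Boolean tree verdict

decomp-a2c hand-2 g22 (crux `AperiodicFrustratedLawGap`, stmt-AtomisticToContinuum-27623; critic rows 769 / 783 (4)(iii) / 801).  The tree driver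
`…HomCertTree.treeOK` and the v2 Gram-leaf checker `leafOK2` (P4) work in the nine GRAM coordinates `⟪U fᵢ, U fⱼ⟫`; the cover root of
`…HomCover` / `…HomPrunedPolar.homFloor_of_prunedBoxSums_selfAdjoint` is the cube of ENTRY coordinates `u_ab = (U e_b) a`, `|u_ab − δ_ab| ≤ 1/4`, of a
self-adjoint positive `U`.  This module closes that gap for the fcc family:

* §1 the real identity `⟪U fᵢ, U fⱼ⟫ = ½ Σₐ (Σ_b u_ab − u_ai)(Σ_b u_ab − u_aj)` (from hand-1's `inner_apply_apply_eq_sum_entries` and `(fᵢ)_b = [b ≠ i]/√2`);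
* §2 its evaluation in the Literature fixed-point interval kernel `Numerics.FI` («interval squaring»): `entryFI`, `offSumFI`, `gramFI`, the Gram box
  `gramC / gramW : Fin 9 → ℤ` of an entry box `(c, w) : Fin 3 × Fin 3 → ℤ` (scaled by `SC = 2^48`, index order `finProdFinEquiv.symm` as in `leafOK2`),
  and ★ `gram_mem_box` : entries in the entry box ⟹ Gram data in the Gram box;
* §3 two FREE leaf verdicts that use the hypotheses of the cover root: `asymOK` (the box contains no symmetric matrix — `U` is self-adjoint) and
  `colOutOK` (some column of `U − 1` is longer than `1/4` on the whole box — impossible under `‖U − 1‖ ≤ 1/4`);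
* §4 the entry-leaf verdict `entryLeafOK μ c w := asymOK ∨ colOutOK ∨ leafOK2 μ (gramC c w) (gramW c w)` with ★ `entryLeafOK_sound`, the generic
  ★★ `fccHalf_of_entryTree` (ANY leaf verdict sound in the stated sense + `treeOK verdict t rootC rootW = true` over the root cube `(SC·δ, SC/4)` ⟹ the
  fcc hypothesis `hfcc` of `homFloor_of_prunedBoxSums_selfAdjoint` VERBATIM, for every `m` with `2 (m + e_W) SC ≤ μ`), and its instance
  ★★ `fccHalf_of_entryLeafTree` for `entryLeafOK`.

The prune disjunct is carried through (`Sound` conclusion `Prune ∨ floor`), so the reflected (P1)/(P2)/(P3) verdicts of the sequel only have to prove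
the same soundness shape and `||`-combine.  All definitions computable (`#eval` / `decide`); 0 sorry; standard axioms; no instances / notation.
`--supports stmt-AtomisticToContinuum-27623`.
-/

namespace Summit.AtomisticToContinuum.Crystallization.Theorems.FrustratedLawDichotomyStrainedPatchHomEntryGram

open scoped BigOperators RealInnerProductSpace
open Literature.Analysis.ValidatedNumerics.Numerics
open Summit.AtomisticToContinuum.Crystallization.Theorems.ChargedEnergyGapNegative (E3)
open Summit.AtomisticToContinuum.Crystallization.Theorems.FrustratedLawDichotomySchurCut (effPot w₄₅ ω₄)
open Summit.AtomisticToContinuum.Crystallization.Theorems.FrustratedLawDichotomyAveragingRuleTightFree (TightNearCap BadNearCap)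
open Summit.AtomisticToContinuum.Crystallization.Theorems.FrustratedLawDichotomyExemptAbsorption (ExemptNear)
open Summit.AtomisticToContinuum.Crystallization.Theorems.FrustratedLawDichotomyStrainedPatchHomSplit
open Summit.AtomisticToContinuum.Crystallization.Theorems.FrustratedLawDichotomyStrainedPatchHomLeafCalculus (inner_apply_apply_eq_sum_entries)
open Summit.AtomisticToContinuum.Crystallization.Theorems.FrustratedLawDichotomyStrainedPatchHomCover (entries_mem_rootCube)
open Summit.AtomisticToContinuum.Crystallization.Theorems.FrustratedLawDichotomyStrainedPatchHomCertTree
open Literature.Barriers.AtomisticToContinuum.FlatleyTheil2015 (fccVec)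

/-! ## §1. Gram data of the fcc frame from the nine entries (real identity) -/

/-- Coordinates of the fcc frame vectors: `(fccVec i) b = 0` if `b = i`, `1/√2` otherwise. [folklore] -/
theorem fccVec_apply (i b : Fin 3) : fccVec i b = if b = i then (0 : ℝ) else (Real.sqrt 2)⁻¹ := by
  fin_cases i <;> fin_cases b <;> simp [fccVec]

/-- `Σ_b u_b (fᵢ)_b = (Σ_b u_b − u_i)/√2`. [folklore] -/
theorem sum_mul_fccVec (u : Fin 3 → ℝ) (i : Fin 3) :
    ∑ b : Fin 3, u b * fccVec i b = ((∑ b : Fin 3, u b) - u i) * (Real.sqrt 2)⁻¹ := by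
  simp only [fccVec_apply, Fin.sum_univ_three]
  fin_cases i <;> simp <;> ring

/-- ★ **Gram datum from entries, fcc frame**: `⟪U fᵢ, U fⱼ⟫ = ½ Σₐ (Σ_b u_ab − u_ai)(Σ_b u_ab − u_aj)` with `u_ab = (U e_b) a`. [folklore] -/
theorem inner_map_fccVec_eq (U : E3 →L[ℝ] E3) (i j : Fin 3) :
    ⟪U (fccVec i), U (fccVec j)⟫ =
      (∑ a : Fin 3, ((∑ b : Fin 3, (U (EuclideanSpace.single b (1 : ℝ))) a) - (U (EuclideanSpace.single i (1 : ℝ))) a) *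
        ((∑ b : Fin 3, (U (EuclideanSpace.single b (1 : ℝ))) a) - (U (EuclideanSpace.single j (1 : ℝ))) a)) / 2 := by
  rw [inner_apply_apply_eq_sum_entries]
  have hc : (Real.sqrt 2)⁻¹ * (Real.sqrt 2)⁻¹ = 1 / 2 := by
    rw [← mul_inv, Real.mul_self_sqrt (by norm_num : (0 : ℝ) ≤ 2)]; norm_num
  rw [Finset.sum_div]
  refine Finset.sum_congr rfl fun a _ => ?_
  rw [sum_mul_fccVec (fun b => (U (EuclideanSpace.single b (1 : ℝ))) a) i,
    sum_mul_fccVec (fun b => (U (EuclideanSpace.single b (1 : ℝ))) a) j]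
  calc ((∑ b : Fin 3, (U (EuclideanSpace.single b (1 : ℝ))) a) - (U (EuclideanSpace.single i (1 : ℝ))) a) * (Real.sqrt 2)⁻¹ *
        (((∑ b : Fin 3, (U (EuclideanSpace.single b (1 : ℝ))) a) - (U (EuclideanSpace.single j (1 : ℝ))) a) * (Real.sqrt 2)⁻¹)
      = ((∑ b : Fin 3, (U (EuclideanSpace.single b (1 : ℝ))) a) - (U (EuclideanSpace.single i (1 : ℝ))) a) *
          ((∑ b : Fin 3, (U (EuclideanSpace.single b (1 : ℝ))) a) - (U (EuclideanSpace.single j (1 : ℝ))) a) *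
          ((Real.sqrt 2)⁻¹ * (Real.sqrt 2)⁻¹) := by ring
    _ = _ := by rw [hc]; ring

/-! ## §2. Interval squaring in the `Numerics.FI` kernel -/

/-- The entry interval of the box coordinate `ab`: `[c − w, c + w]` (scaled). -/
def entryFI (c w : Fin 3 × Fin 3 → ℤ) (ab : Fin 3 × Fin 3) : FI := ⟨c ab - w ab, c ab + w ab⟩

/-- `Σ_{b ≠ i} u_ab` in the kernel (the two entries of row `a` off column `i`). -/
def offSumFI (E : Fin 3 × Fin 3 → FI) (i a : Fin 3) : FI :=
  if i = 0 then (E (a, 1)).add (E (a, 2)) else if i = 1 then (E (a, 0)).add (E (a, 2)) else (E (a, 0)).add (E (a, 1))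

/-- The Gram entry `⟪U fᵢ, U fⱼ⟫` in the kernel: `(Σₐ offSum i a · offSum j a) / 2`. -/
def gramFI (E : Fin 3 × Fin 3 → FI) (i j : Fin 3) : FI :=
  ((((offSumFI E i 0).mul (offSumFI E j 0)).add ((offSumFI E i 1).mul (offSumFI E j 1))).add
    ((offSumFI E i 2).mul (offSumFI E j 2))).divNat 2

/-- Integer centre of an interval. -/
def cen (I : FI) : ℤ := (I.lo + I.hi) / 2

/-- Integer half-width of an interval about `cen`. -/
def rad (I : FI) : ℤ := max (I.hi - cen I) (cen I - I.lo)

/-- Gram-box CENTRE of the entry box `(c, w)`, index order of `leafOK2` (`k ↦ finProdFinEquiv.symm k`). -/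
def gramC (c w : Fin 3 × Fin 3 → ℤ) : Fin 9 → ℤ := fun k =>
  cen (gramFI (entryFI c w) ((@finProdFinEquiv 3 3).symm k).1 ((@finProdFinEquiv 3 3).symm k).2)

/-- Gram-box HALF-WIDTHS of the entry box `(c, w)`. -/
def gramW (c w : Fin 3 × Fin 3 → ℤ) : Fin 9 → ℤ := fun k =>
  rad (gramFI (entryFI c w) ((@finProdFinEquiv 3 3).symm k).1 ((@finProdFinEquiv 3 3).symm k).2)

/-- Centre/half-width membership ⟹ kernel membership. [formal bookkeeping] -/
theorem mem_entryFI {x : ℝ} {c w : Fin 3 × Fin 3 → ℤ} {ab : Fin 3 × Fin 3} (h : |x - (c ab : ℝ) / SC| ≤ (w ab : ℝ) / SC) :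
    FI.mem x (entryFI c w ab) := by
  have hS := SC_pos
  have hne := SC_ne
  have key : |x * SC - c ab| ≤ w ab := by
    rw [show x * SC - c ab = (x - (c ab : ℝ) / SC) * SC by field_simp, abs_mul, abs_of_pos hS]
    exact (le_div_iff₀ hS).mp h
  obtain ⟨h1, h2⟩ := abs_le.mp key
  rw [FI.mem_def]
  simp only [entryFI]
  push_cast
  constructor <;> linarith

/-- Kernel membership ⟹ centre/half-width membership about `(cen, rad)`. [formal bookkeeping] -/
theorem abs_sub_cen_le {x : ℝ} {I : FI} (h : FI.mem x I) : |x - (cen I : ℝ) / SC| ≤ (rad I : ℝ) / SC := by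
  have hS := SC_pos
  have hne := SC_ne
  obtain ⟨h1, h2⟩ := FI.mem_def.mp h
  have key : |x * SC - cen I| ≤ rad I := by
    rw [abs_le]
    simp only [rad]
    push_cast
    constructor
    · linarith [le_max_right ((I.hi : ℝ) - cen I) ((cen I : ℝ) - I.lo)]
    · linarith [le_max_left ((I.hi : ℝ) - cen I) ((cen I : ℝ) - I.lo)]
  rw [show x - (cen I : ℝ) / SC = (x * SC - cen I) / SC by field_simp, abs_div, abs_of_pos hS]
  exact div_le_div_of_nonneg_right key hS.le

/-- `offSumFI` encloses `Σ_b u_ab − u_ai`. [formal bookkeeping] -/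
theorem mem_offSumFI {u : Fin 3 × Fin 3 → ℝ} {E : Fin 3 × Fin 3 → FI} (h : ∀ ab, FI.mem (u ab) (E ab)) (i a : Fin 3) :
    FI.mem ((∑ b : Fin 3, u (a, b)) - u (a, i)) (offSumFI E i a) := by
  simp only [offSumFI, Fin.sum_univ_three]
  fin_cases i
  · simpa using (show FI.mem (u (a, 0) + u (a, 1) + u (a, 2) - u (a, 0)) ((E (a, 1)).add (E (a, 2))) by
      have e : u (a, 0) + u (a, 1) + u (a, 2) - u (a, 0) = u (a, 1) + u (a, 2) := by ring
      rw [e]; exact FI.mem_add (h (a, 1)) (h (a, 2)))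
  · simpa using (show FI.mem (u (a, 0) + u (a, 1) + u (a, 2) - u (a, 1)) ((E (a, 0)).add (E (a, 2))) by
      have e : u (a, 0) + u (a, 1) + u (a, 2) - u (a, 1) = u (a, 0) + u (a, 2) := by ring
      rw [e]; exact FI.mem_add (h (a, 0)) (h (a, 2)))
  · simpa using (show FI.mem (u (a, 0) + u (a, 1) + u (a, 2) - u (a, 2)) ((E (a, 0)).add (E (a, 1))) by
      have e : u (a, 0) + u (a, 1) + u (a, 2) - u (a, 2) = u (a, 0) + u (a, 1) := by ring
      rw [e]; exact FI.mem_add (h (a, 0)) (h (a, 1)))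

/-- ★ `gramFI` encloses `⟪U fᵢ, U fⱼ⟫` when the entries are enclosed. [formal bookkeeping] -/
theorem mem_gramFI (U : E3 →L[ℝ] E3) {E : Fin 3 × Fin 3 → FI}
    (h : ∀ ab : Fin 3 × Fin 3, FI.mem ((U (EuclideanSpace.single ab.2 (1 : ℝ))) ab.1) (E ab)) (i j : Fin 3) :
    FI.mem ⟪U (fccVec i), U (fccVec j)⟫ (gramFI E i j) := by
  rw [inner_map_fccVec_eq]
  have hu : ∀ ab : Fin 3 × Fin 3, FI.mem ((fun ab : Fin 3 × Fin 3 => (U (EuclideanSpace.single ab.2 (1 : ℝ))) ab.1) ab) (E ab) := h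
  have hS := fun (i a : Fin 3) => mem_offSumFI (u := fun ab : Fin 3 × Fin 3 => (U (EuclideanSpace.single ab.2 (1 : ℝ))) ab.1) hu i a
  have hsum := FI.mem_add (FI.mem_add (FI.mem_mul (hS i 0) (hS j 0)) (FI.mem_mul (hS i 1) (hS j 1))) (FI.mem_mul (hS i 2) (hS j 2))
  have h2 := FI.mem_divNat (n := 2) hsum (by norm_num)
  simp only [Nat.cast_ofNat, Fin.sum_univ_three] at h2
  simp only [gramFI, Fin.sum_univ_three]
  exact h2

/-- ★ **INTERVAL SQUARING**: entries of `U` in the entry box `(c, w)` ⟹ the nine Gram data `⟪U fᵢ, U fⱼ⟫` in the Gram box `(gramC c w, gramW c w)`,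
in the exact hypothesis shape of `…HomCertTree.leafOK2_sound` / `…HomLeafCheckW.leaf_sound2`. [folklore] -/
theorem gram_mem_box (U : E3 →L[ℝ] E3) {c w : Fin 3 × Fin 3 → ℤ}
    (hbox : ∀ ab : Fin 3 × Fin 3, |(U (EuclideanSpace.single ab.2 (1 : ℝ))) ab.1 - (c ab : ℝ) / SC| ≤ (w ab : ℝ) / SC) (k : Fin 9) :
    |⟪U (fccVec ((@finProdFinEquiv 3 3).symm k).1), U (fccVec ((@finProdFinEquiv 3 3).symm k).2)⟫ - (gramC c w k : ℝ) / SC| ≤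
      (gramW c w k : ℝ) / SC :=
  abs_sub_cen_le (mem_gramFI U (fun ab => mem_entryFI (hbox ab)) _ _)

/-! ## §3. Two free verdicts from the root hypotheses (self-adjointness, `‖U − 1‖ ≤ 1/4`) -/

/-- Pair test: the mirrored coordinates `ab`, `ba` have disjoint intervals. -/
def asymPair (c w : Fin 3 × Fin 3 → ℤ) (a b : Fin 3) : Bool := decide (w (a, b) + w (b, a) < |c (a, b) - c (b, a)|)

/-- ★ **Symmetry prune**: the entry box contains NO symmetric matrix (then it contains no self-adjoint `U`: vacuous leaf). -/
def asymOK (c w : Fin 3 × Fin 3 → ℤ) : Bool := asymPair c w 0 1 || asymPair c w 0 2 || asymPair c w 1 2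

/-- Soundness of the pair test: symmetric entries cannot lie in disjoint mirrored intervals. [folklore] -/
theorem false_of_asymPair {c w : Fin 3 × Fin 3 → ℤ} {a b : Fin 3} (h : asymPair c w a b = true) {u : Fin 3 × Fin 3 → ℝ}
    (hsym : u (a, b) = u (b, a)) (hbox : ∀ ab, |u ab - (c ab : ℝ) / SC| ≤ (w ab : ℝ) / SC) : False := by
  have hS := SC_pos
  have h1 := hbox (a, b)
  have h2 := hbox (b, a)
  rw [hsym] at h1
  have key : |(c (a, b) : ℝ) / SC - (c (b, a) : ℝ) / SC| ≤ (w (a, b) : ℝ) / SC + (w (b, a) : ℝ) / SC := by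
    calc |(c (a, b) : ℝ) / SC - (c (b, a) : ℝ) / SC|
        = |(u (b, a) - (c (b, a) : ℝ) / SC) - (u (b, a) - (c (a, b) : ℝ) / SC)| := by ring_nf
      _ ≤ |u (b, a) - (c (b, a) : ℝ) / SC| + |u (b, a) - (c (a, b) : ℝ) / SC| := abs_sub _ _
      _ ≤ _ := by linarith
  have key' : |((c (a, b) - c (b, a) : ℤ) : ℝ)| ≤ ((w (a, b) + w (b, a) : ℤ) : ℝ) := by
    have := mul_le_mul_of_nonneg_right key hS.le
    rw [← sub_div, abs_div, abs_of_pos hS, div_mul_cancel₀ _ SC_ne, ← add_div, div_mul_cancel₀ _ SC_ne] at this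
    push_cast; exact this
  have hlt : w (a, b) + w (b, a) < |c (a, b) - c (b, a)| := by simpa [asymPair] using h
  have hlt' : ((w (a, b) + w (b, a) : ℤ) : ℝ) < |((c (a, b) - c (b, a) : ℤ) : ℝ)| := by
    rw [← Int.cast_abs]; exact_mod_cast hlt
  linarith

/-- Soundness of the symmetry prune. [folklore] -/
theorem false_of_asymOK {c w : Fin 3 × Fin 3 → ℤ} (h : asymOK c w = true) {u : Fin 3 × Fin 3 → ℝ} (hsym : ∀ a b : Fin 3, u (a, b) = u (b, a))
    (hbox : ∀ ab, |u ab - (c ab : ℝ) / SC| ≤ (w ab : ℝ) / SC) : False := by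
  simp only [asymOK, Bool.or_eq_true] at h
  rcases h with (h | h) | h
  · exact false_of_asymPair h (hsym 0 1) hbox
  · exact false_of_asymPair h (hsym 0 2) hbox
  · exact false_of_asymPair h (hsym 1 2) hbox

/-- Scaled lower bound for `|u_ab − δ_ab|` on the box: `max 0 (|c − δ·SC| − w)`. -/
def devLo (c w : Fin 3 × Fin 3 → ℤ) (ab : Fin 3 × Fin 3) : ℤ :=
  max 0 (|c ab - (if ab.1 = ab.2 then (SC : ℤ) else 0)| - w ab)

/-- Column test: column `b` of `U − 1` has squared length `> (SC/4)²` on the whole box (scaled). -/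
def colOutCol (c w : Fin 3 × Fin 3 → ℤ) (b : Fin 3) : Bool :=
  decide ((SC : ℤ) * SC < 16 * (devLo c w (0, b) ^ 2 + devLo c w (1, b) ^ 2 + devLo c w (2, b) ^ 2))

/-- ★ **Column prune**: some column of `U − 1` is longer than `1/4` on the whole box (then `‖U − 1‖ > 1/4`: vacuous leaf). -/
def colOutOK (c w : Fin 3 × Fin 3 → ℤ) : Bool := colOutCol c w 0 || colOutCol c w 1 || colOutCol c w 2

/-- `devLo/SC ≤ |u_ab − δ_ab|` on the box. [formal bookkeeping] -/
theorem devLo_le {c w : Fin 3 × Fin 3 → ℤ} {u : Fin 3 × Fin 3 → ℝ} (hbox : ∀ ab, |u ab - (c ab : ℝ) / SC| ≤ (w ab : ℝ) / SC)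
    (ab : Fin 3 × Fin 3) : (devLo c w ab : ℝ) / SC ≤ |u ab - (if ab.1 = ab.2 then (1 : ℝ) else 0)| := by
  have hS := SC_pos
  have hne := SC_ne
  have hb : |u ab * SC - c ab| ≤ w ab := by
    rw [show u ab * SC - c ab = (u ab - (c ab : ℝ) / SC) * SC by field_simp, abs_mul, abs_of_pos hS]
    exact (le_div_iff₀ hS).mp (hbox ab)
  set δ : ℝ := (if ab.1 = ab.2 then (1 : ℝ) else 0) with hδ
  have hδZ : (if ab.1 = ab.2 then (SC : ℝ) else 0) = δ * SC := by
    rw [hδ]; split_ifs <;> simp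
  rw [div_le_iff₀ hS]
  have e : |u ab * SC - δ * SC| = |u ab - δ| * SC := by
    rw [← sub_mul, abs_mul, abs_of_pos hS]
  rw [← e]
  simp only [devLo]
  push_cast
  rw [hδZ]
  refine max_le (abs_nonneg _) ?_
  have tri : |(c ab : ℝ) - δ * SC| ≤ |u ab * SC - c ab| + |u ab * SC - δ * SC| := by
    calc |(c ab : ℝ) - δ * SC| = |(u ab * SC - δ * SC) - (u ab * SC - c ab)| := by ring_nf
      _ ≤ |u ab * SC - δ * SC| + |u ab * SC - c ab| := abs_sub _ _
      _ = _ := add_comm _ _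
  linarith

/-- Soundness of one column test. [folklore] -/
theorem false_of_colOutCol {c w : Fin 3 × Fin 3 → ℤ} {b : Fin 3} (h : colOutCol c w b = true) (U : E3 →L[ℝ] E3) (hU : ‖U - 1‖ ≤ 1 / 4)
    (hbox : ∀ ab : Fin 3 × Fin 3, |(U (EuclideanSpace.single ab.2 (1 : ℝ))) ab.1 - (c ab : ℝ) / SC| ≤ (w ab : ℝ) / SC) : False := by
  have hS := SC_pos
  -- the column `b` of `U − 1` has norm ≤ 1/4
  have h1 : ‖(U - 1) (EuclideanSpace.single b (1 : ℝ))‖ ≤ 1 / 4 := by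
    calc ‖(U - 1) (EuclideanSpace.single b (1 : ℝ))‖ ≤ ‖U - 1‖ * ‖EuclideanSpace.single b (1 : ℝ)‖ := (U - 1).le_opNorm _
      _ = ‖U - 1‖ := by simp
      _ ≤ 1 / 4 := hU
  have h3 : ∀ a : Fin 3, ((U - 1) (EuclideanSpace.single b (1 : ℝ))) a =
      (U (EuclideanSpace.single b (1 : ℝ))) a - (if a = b then (1 : ℝ) else 0) := fun a => by
    simp [PiLp.single_apply]
  have hsq : ∑ a : Fin 3, ((U (EuclideanSpace.single b (1 : ℝ))) a - (if a = b then (1 : ℝ) else 0)) ^ 2 ≤ (1 / 4) ^ 2 := by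
    have e : ‖(U - 1) (EuclideanSpace.single b (1 : ℝ))‖ ^ 2 =
        ∑ a : Fin 3, ((U (EuclideanSpace.single b (1 : ℝ))) a - (if a = b then (1 : ℝ) else 0)) ^ 2 := by
      rw [EuclideanSpace.norm_sq_eq]
      exact Finset.sum_congr rfl fun a _ => by rw [Real.norm_eq_abs, sq_abs, h3]
    rw [← e]
    exact pow_le_pow_left₀ (norm_nonneg _) h1 2
  -- each summand dominates `(devLo/SC)²`
  have hdev : ∀ a : Fin 3, ((devLo c w (a, b) : ℝ) / SC) ^ 2 ≤
      ((U (EuclideanSpace.single b (1 : ℝ))) a - (if a = b then (1 : ℝ) else 0)) ^ 2 := fun a => by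
    have hd := devLo_le (u := fun ab : Fin 3 × Fin 3 => (U (EuclideanSpace.single ab.2 (1 : ℝ))) ab.1) hbox (a, b)
    have h0 : 0 ≤ (devLo c w (a, b) : ℝ) / SC := div_nonneg (by exact_mod_cast le_max_left _ _) hS.le
    calc ((devLo c w (a, b) : ℝ) / SC) ^ 2 ≤ |(U (EuclideanSpace.single b (1 : ℝ))) a - (if a = b then (1 : ℝ) else 0)| ^ 2 :=
          pow_le_pow_left₀ h0 hd 2
      _ = _ := sq_abs _
  have hsum : ((devLo c w (0, b) : ℝ) / SC) ^ 2 + ((devLo c w (1, b) : ℝ) / SC) ^ 2 + ((devLo c w (2, b) : ℝ) / SC) ^ 2 ≤ (1 / 4) ^ 2 := by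
    rw [Fin.sum_univ_three] at hsq
    linarith [hdev 0, hdev 1, hdev 2]
  have hlt : (SC : ℤ) * SC < 16 * (devLo c w (0, b) ^ 2 + devLo c w (1, b) ^ 2 + devLo c w (2, b) ^ 2) := by
    simpa [colOutCol] using h
  have hlt' : (SC : ℝ) * SC < 16 * ((devLo c w (0, b) : ℝ) ^ 2 + (devLo c w (1, b) : ℝ) ^ 2 + (devLo c w (2, b) : ℝ) ^ 2) := by
    exact_mod_cast hlt
  have e : ((devLo c w (0, b) : ℝ) / SC) ^ 2 + ((devLo c w (1, b) : ℝ) / SC) ^ 2 + ((devLo c w (2, b) : ℝ) / SC) ^ 2 =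
      ((devLo c w (0, b) : ℝ) ^ 2 + (devLo c w (1, b) : ℝ) ^ 2 + (devLo c w (2, b) : ℝ) ^ 2) / (SC * SC) := by
    field_simp
  rw [e, div_le_iff₀ (mul_pos hS hS)] at hsum
  nlinarith

/-- Soundness of the column prune. [folklore] -/
theorem false_of_colOutOK {c w : Fin 3 × Fin 3 → ℤ} (h : colOutOK c w = true) (U : E3 →L[ℝ] E3) (hU : ‖U - 1‖ ≤ 1 / 4)
    (hbox : ∀ ab : Fin 3 × Fin 3, |(U (EuclideanSpace.single ab.2 (1 : ℝ))) ab.1 - (c ab : ℝ) / SC| ≤ (w ab : ℝ) / SC) : False := by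
  simp only [colOutOK, Bool.or_eq_true] at h
  rcases h with (h | h) | h <;> exact false_of_colOutCol h U hU hbox

/-! ## §4. The entry-leaf verdict, its soundness, and the fcc half from one tree verdict -/

/-- ★ **ENTRY-LEAF VERDICT (fcc)**: symmetry prune ∨ column prune ∨ the v2 Gram-leaf checker (P4) on the squared box. -/
def entryLeafOK (μ : ℤ) (c w : Fin 3 × Fin 3 → ℤ) : Bool := asymOK c w || colOutOK c w || leafOK2 μ (gramC c w) (gramW c w)

/-- ★ **Soundness of `entryLeafOK`** in the shape consumed by `fccHalf_of_entryTree`: for every SELF-ADJOINT `U` with `‖U − 1‖ ≤ 1/4` whose entries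
lie in the box, the prune disjunct holds or `μ/SC ≤ Σ_b W₄₅ ‖latPt U fccVec b‖`. [folklore] -/
theorem entryLeafOK_sound {μ : ℤ} {c w : Fin 3 × Fin 3 → ℤ} (h : entryLeafOK μ c w = true) (U : E3 →L[ℝ] E3)
    (hsa : ∀ v v' : E3, ⟪U v, v'⟫ = ⟪v, U v'⟫) (hU : ‖U - 1‖ ≤ 1 / 4)
    (hbox : ∀ ab : Fin 3 × Fin 3, |(U (EuclideanSpace.single ab.2 (1 : ℝ))) ab.1 - (c ab : ℝ) / SC| ≤ (w ab : ℝ) / SC) :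
    (∀ (M : ℕ) (z : Fin M → E3) (c : Fin M), Function.Injective z →
        Set.range z = {x : E3 | dist x (z c) ≤ 133 / 10 ∧ ∃ a : Fin 3 → ℤ, x = z c + latPt U fccVec a} →
        TightNearCap (9 / 5) (3 / 2) z c ∨ ExemptNear (9 / 5) ExRec z c ∨ BadNearCap (9 / 5) (3 / 2) z c) ∨
      (μ : ℝ) / SC ≤ ∑ b ∈ (Fintype.piFinset fun _ : Fin 3 => Finset.Icc (-7 : ℤ) 7).filter (fun b => b ≠ 0),
        effPot w₄₅ ω₄ (3 / 400) ‖latPt U fccVec b‖ := by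
  simp only [entryLeafOK, Bool.or_eq_true] at h
  rcases h with (h | h) | h
  · -- symmetric entries: `(U e_b) a = ⟪e_a, U e_b⟫ = ⟪U e_a, e_b⟫ = (U e_a) b`
    have hsym : ∀ a b : Fin 3, (U (EuclideanSpace.single b (1 : ℝ))) a = (U (EuclideanSpace.single a (1 : ℝ))) b := fun a b => by
      have e1 : (U (EuclideanSpace.single b (1 : ℝ))) a = ⟪EuclideanSpace.single a (1 : ℝ), U (EuclideanSpace.single b (1 : ℝ))⟫ := by
        rw [EuclideanSpace.inner_single_left]; simp
      have e2 : (U (EuclideanSpace.single a (1 : ℝ))) b = ⟪EuclideanSpace.single b (1 : ℝ), U (EuclideanSpace.single a (1 : ℝ))⟫ := by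
        rw [EuclideanSpace.inner_single_left]; simp
      rw [e1, e2, ← hsa, real_inner_comm]
    exact (false_of_asymOK h (u := fun ab : Fin 3 × Fin 3 => (U (EuclideanSpace.single ab.2 (1 : ℝ))) ab.1)
      (fun a b => hsym a b) hbox).elim
  · exact (false_of_colOutOK h U hU hbox).elim
  · exact Or.inr (leafOK2_sound h U (gram_mem_box U hbox))

/-- Root CENTRE of the entry cube: `SC · δ_ab`. -/
def rootC : Fin 3 × Fin 3 → ℤ := fun ab => if ab.1 = ab.2 then (SC : ℤ) else 0

/-- Root HALF-WIDTH of the entry cube: `SC/4 = 2^46` (even 46 times over, so the tree may bisect every coordinate 46 times). -/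
def rootW : Fin 3 × Fin 3 → ℤ := fun _ => 70368744177664

/-- `rootW = SC/4` as a real number. [formal bookkeeping] -/
theorem rootW_div : ((70368744177664 : ℤ) : ℝ) / SC = 1 / 4 := by norm_num [SC]

/-- The root cube is the cube of `…HomCover.entries_mem_rootCube`. [formal bookkeeping] -/
theorem mem_root_of_near_one {U : E3 →L[ℝ] E3} (hU : ‖U - 1‖ ≤ 1 / 4) (ab : Fin 3 × Fin 3) :
    |(U (EuclideanSpace.single ab.2 (1 : ℝ))) ab.1 - (rootC ab : ℝ) / SC| ≤ (rootW ab : ℝ) / SC := by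
  have h := entries_mem_rootCube hU ab
  have e1 : (rootC ab : ℝ) / SC = if ab.1 = ab.2 then (1 : ℝ) else 0 := by
    simp only [rootC]
    split_ifs
    · push_cast; exact div_self SC_ne
    · simp
  rw [e1, show (rootW ab : ℝ) / SC = 1 / 4 from rootW_div]
  exact h

/-- ★★ **THE fcc HALF FROM ONE TREE VERDICT (generic leaf verdict).**  If a leaf verdict is sound in the sense of `entryLeafOK_sound` and the tree
driver accepts the root cube, then the fcc hypothesis `hfcc` of `…HomPrunedPolar.homFloor_of_prunedBoxSums_selfAdjoint` holds VERBATIM for every `m`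
with `2 (m + e_W) · SC ≤ μ` (`e_W = −7175/10000 + 3/400`). [folklore] -/
theorem fccHalf_of_entryTree {m : ℝ} {μ : ℤ} (hμ : 2 * (m + (-(7175 / 10000) + 3 / 400)) * SC ≤ μ)
    (verdict : (Fin 3 × Fin 3 → ℤ) → (Fin 3 × Fin 3 → ℤ) → Bool)
    (hver : ∀ c w, verdict c w = true → ∀ U : E3 →L[ℝ] E3, (∀ v v' : E3, ⟪U v, v'⟫ = ⟪v, U v'⟫) → ‖U - 1‖ ≤ 1 / 4 →
      (∀ ab : Fin 3 × Fin 3, |(U (EuclideanSpace.single ab.2 (1 : ℝ))) ab.1 - (c ab : ℝ) / SC| ≤ (w ab : ℝ) / SC) →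
      (∀ (M : ℕ) (z : Fin M → E3) (c : Fin M), Function.Injective z →
          Set.range z = {x : E3 | dist x (z c) ≤ 133 / 10 ∧ ∃ a : Fin 3 → ℤ, x = z c + latPt U fccVec a} →
          TightNearCap (9 / 5) (3 / 2) z c ∨ ExemptNear (9 / 5) ExRec z c ∨ BadNearCap (9 / 5) (3 / 2) z c) ∨
        (μ : ℝ) / SC ≤ ∑ b ∈ (Fintype.piFinset fun _ : Fin 3 => Finset.Icc (-7 : ℤ) 7).filter (fun b => b ≠ 0),
          effPot w₄₅ ω₄ (3 / 400) ‖latPt U fccVec b‖)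
    {t : CertTree (Fin 3 × Fin 3)} (h : treeOK verdict t rootC rootW = true) :
    ∀ U : E3 →L[ℝ] E3, (∀ v w : E3, inner ℝ (U v) w = inner ℝ v (U w)) → (∀ w : E3, 0 ≤ inner ℝ w (U w)) → ‖U - 1‖ ≤ 1 / 4 →
      (∀ (M : ℕ) (z : Fin M → E3) (c : Fin M), Function.Injective z →
          Set.range z = {x : E3 | dist x (z c) ≤ 133 / 10 ∧ ∃ a : Fin 3 → ℤ, x = z c + latPt U fccVec a} →
          TightNearCap (9 / 5) (3 / 2) z c ∨ ExemptNear (9 / 5) ExRec z c ∨ BadNearCap (9 / 5) (3 / 2) z c) ∨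
      m ≤ (∑ b ∈ (Fintype.piFinset fun _ : Fin 3 => Finset.Icc (-7 : ℤ) 7).filter (fun b => b ≠ 0),
        effPot w₄₅ ω₄ (3 / 400) ‖latPt U fccVec b‖) / 2 - (-(7175 / 10000) + 3 / 400) := by
  intro U hsa _hpos hU
  have hS := SC_pos
  -- run the driver with `P x := ∀ U self-adjoint with ‖U − 1‖ ≤ 1/4 and entries x, prune ∨ μ-floor`
  have key := treeOK_sound SC_pos
    (P := fun x : Fin 3 × Fin 3 → ℝ => ∀ U : E3 →L[ℝ] E3, (∀ v v' : E3, ⟪U v, v'⟫ = ⟪v, U v'⟫) → ‖U - 1‖ ≤ 1 / 4 →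
      (∀ ab : Fin 3 × Fin 3, (U (EuclideanSpace.single ab.2 (1 : ℝ))) ab.1 = x ab) →
      (∀ (M : ℕ) (z : Fin M → E3) (c : Fin M), Function.Injective z →
          Set.range z = {x : E3 | dist x (z c) ≤ 133 / 10 ∧ ∃ a : Fin 3 → ℤ, x = z c + latPt U fccVec a} →
          TightNearCap (9 / 5) (3 / 2) z c ∨ ExemptNear (9 / 5) ExRec z c ∨ BadNearCap (9 / 5) (3 / 2) z c) ∨
        (μ : ℝ) / SC ≤ ∑ b ∈ (Fintype.piFinset fun _ : Fin 3 => Finset.Icc (-7 : ℤ) 7).filter (fun b => b ≠ 0),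
          effPot w₄₅ ω₄ (3 / 400) ‖latPt U fccVec b‖)
    verdict (fun c w hv x hx V hVsa hV1 hVx => hver c w hv V hVsa hV1 fun ab => by rw [hVx ab]; exact hx ab) t rootC rootW h
    (fun ab => (U (EuclideanSpace.single ab.2 (1 : ℝ))) ab.1) (mem_root_of_near_one hU) U hsa hU (fun _ => rfl)
  refine key.imp id fun hfloor => ?_
  have h2 : 2 * (m + (-(7175 / 10000) + 3 / 400)) ≤ (μ : ℝ) / SC := by
    rw [le_div_iff₀ hS]; exact hμ
  linarith

/-- ★★ **THE fcc HALF FROM ONE BOOLEAN**: `treeOK (entryLeafOK μ) t rootC rootW = true` with `2 (m + e_W) SC ≤ μ` ⟹ the fcc hypothesis of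
`homFloor_of_prunedBoxSums_selfAdjoint` for `m`. [folklore] -/
theorem fccHalf_of_entryLeafTree {m : ℝ} {μ : ℤ} (hμ : 2 * (m + (-(7175 / 10000) + 3 / 400)) * SC ≤ μ)
    {t : CertTree (Fin 3 × Fin 3)} (h : treeOK (entryLeafOK μ) t rootC rootW = true) :
    ∀ U : E3 →L[ℝ] E3, (∀ v w : E3, inner ℝ (U v) w = inner ℝ v (U w)) → (∀ w : E3, 0 ≤ inner ℝ w (U w)) → ‖U - 1‖ ≤ 1 / 4 →
      (∀ (M : ℕ) (z : Fin M → E3) (c : Fin M), Function.Injective z →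
          Set.range z = {x : E3 | dist x (z c) ≤ 133 / 10 ∧ ∃ a : Fin 3 → ℤ, x = z c + latPt U fccVec a} →
          TightNearCap (9 / 5) (3 / 2) z c ∨ ExemptNear (9 / 5) ExRec z c ∨ BadNearCap (9 / 5) (3 / 2) z c) ∨
      m ≤ (∑ b ∈ (Fintype.piFinset fun _ : Fin 3 => Finset.Icc (-7 : ℤ) 7).filter (fun b => b ≠ 0),
        effPot w₄₅ ω₄ (3 / 400) ‖latPt U fccVec b‖) / 2 - (-(7175 / 10000) + 3 / 400) :=
  fccHalf_of_entryTree hμ (entryLeafOK μ) (fun _ _ hv U hsa hU hbox => entryLeafOK_sound hv U hsa hU hbox) h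

/-! ## §5. Kernel smoke tests -/

/-- The Gram box of the root cube's CENTRE leaf (identity entries, zero width) is the thin ideal fcc Gram `(1, ½, …)`; the symmetry prune fires on
a box separated from its mirror; the column prune fires on a corner box of the root cube. -/
example : gramC rootC (fun _ => 0) 0 = (SC : ℤ) ∧ gramW rootC (fun _ => 0) 0 = 0 ∧ 2 * gramC rootC (fun _ => 0) 1 = (SC : ℤ) ∧
    asymOK (Function.update rootC (0, 1) 3) (fun _ => 1) = true ∧ asymOK rootC (fun _ => 1) = false ∧
    colOutOK (fun ab => rootC ab + 60000000000000) (fun _ => 1000) = true ∧ colOutOK rootC rootW = false := by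
  decide +kernel

end Summit.AtomisticToContinuum.Crystallization.Theorems.FrustratedLawDichotomyStrainedPatchHomEntryGram
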